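import Mathlib
import HarnessLib
import Summits.HubbardSuperconductivity.HubbardSuperconductivity.Theorems.KLProgrammeKLRegimeEngineTowerImportP2Count
import Summits.HubbardSuperconductivity.HubbardSuperconductivity.Theorems.KLProgrammeKLRegimeEngineTowerLevStepLinkUnitsF

/-!
# Route `KLProgramme` — crux K3 ENGINE (stmt-HubbardSuperconductivity-20437 `KLRegimeEngineV17F2`), stub (b) v2, THE LEVELS PACKAGE (ℓ), import (I4) at four legs
# IN FLOOR UNITS: the measured floor array of degree `4` from the one-anchor count (levels ≤ 2) and a THREE-ANCHOR count (levels 3, 4)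
# (located «(ℓ)-IMPORT-ι₂-FLOOR», KL STATUS 2026-08-29; cell gate-hubbard-kl, seat hubbard-kl-k3c2-p3 g14, row «sector-counting import»; E1 may rename or supersede)

The F-law's import row `himp₂ : W·Z²·klTowerMuLevF … d k 2 ≤ ῑ₂′·λ` reads the TRACK-BLIND floor array
`klTowerMuLevF … d k 2 = max_t 27^{t+1}·klTowerMeasLev … d k 4 (t+1) / klLevUnitF β M t 2 (dk−1)`, and `klLevUnitF β M t 2 J = ε³·2^J/2^{klLevGain t·J}`
(`klLevUnitF_two_eq`): tracks `t = 0, 1` carry the unit `ε³·2^J`, tracks `t = 2, 3` the unit `ε³`, track `4` is empty for four legs.  The landed import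
(`…TowerImportP2Count.klTowerMeasLev_four_le_thinCount_mul`, ONE anchored leg, `≤ klThinCountC·sectorCount J·Bₐ` at every level) pays `sectorCount J = 2·2^J`
against `2^J` at tracks `0, 1` but against `1` at tracks `2, 3` — a factor `2^{dk}` (located «(ℓ)-IMPORT-ι₂-FLOOR»).  At levels `F ≥ 3` a leg sum pinned at `p`
over the prescription fixes at least THREE labels, so a THREE-ANCHOR count `#{Ω ∈ bgmSectorSet(F_J) 4 : Ω|_E = τ|_E} ≤ N₃` (`|E| ≥ 3`; absolute by the cell
geometry — `lastLeg_count_perturbedCurve_le`, to be instantiated) is what these tracks need: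

* §1 `klLevUnitF_two_eq`; `card_filter_prescribedTuples_le_of_threeCount` (a prescription of level `≥ 3` plus the pin fixes `≥ 3` legs);
  **`klLevNormOf_four_le_threeCount_mul`** — `levelCount Ωe ≥ 3 ⇒ klLevNormOf … J 4 T Ωe ≤ N₃·Bₐ` (any `T`, all-fixed anisotropic line `Bₐ` as in …ImportP2Count);
* §2 **`klTowerMeasLev_four_le_threeCount_mul`** — the tower instance at `F ≥ 3`;
* §3 **`klTowerMuLevF_two_le_floor_import`** — under the doors of the one-anchor count (…ImportP2Count §2) and a three-anchor count `N₃`: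
  `klTowerMuLevF … d k 2 ≤ (1458·klThinCountC + 531441·N₃)·Bₐ/ε³` — k-UNIFORM; i.e. `ῑ₂′·λ = W·Z²·(1458·klThinCountC + 27⁴·N₃)·Bₐ/ε³` with `Z ∝ ε²`.
The all-fixed line `Bₐ` (E1's (Q-ι₂), or the plain line via …ImportP2Plain) and the three-anchor count `N₃` are hypotheses here.  Nothing about the model is asserted
beyond the landed counts; nothing asserts (ℓ), any stub, K3 or superconductivity.
References: BGM 2006 §2.7 (2.71a), §2.8 (2.76)–(2.77), (2.96)–(2.98), Lemma 2.5, App. A3 [cite: BenfattoGiulianiMastropietro2006].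
-/

noncomputable section

namespace Summit.HubbardSuperconductivity.HubbardSuperconductivity.Theorems.EngineV8

set_option linter.dupNamespace false -- summit = problem name (single-conjunct summit), D-0017

open Classical
open Real Finset Literature.MathematicalPhysics.QuantumLattice Literature.Probability.LatticeModels
open Literature.MathematicalPhysics.QuantumLattice.FermiRG
open Summit.HubbardSuperconductivity.HubbardSuperconductivity.Theorems.KLRegimeSplit
open Summit.HubbardSuperconductivity.HubbardSuperconductivity.Theorems.KLProgrammeLegKernels
open Summit.HubbardSuperconductivity.HubbardSuperconductivity.Theorems.DispersionFlow

variable {L M : ℕ} [NeZero L]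

/-! ## §1 The four-leg floor unit and the levelled norm at levels `≥ 3` -/

omit [NeZero L] in
/-- **The four-leg floor unit**: `klLevUnitF β M t 2 J = ε³·2^J/2^{klLevGain t·J}`. -/
theorem klLevUnitF_two_eq (β : ℝ) (M : ℕ) (t : Fin 5) (J : ℕ) :
    klLevUnitF β M t 2 J = imagTimeWeight β M ^ 3 * (2 : ℝ) ^ J / (2 : ℝ) ^ (klLevGain t * J) := by
  unfold klLevUnitF
  have h8 : (8 : ℝ) ^ (J * 2) = (2 : ℝ) ^ (5 * J) * (2 : ℝ) ^ J := by
    rw [show (8 : ℝ) = 2 ^ 3 by norm_num, ← pow_mul, ← pow_add]; congr 1; ring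
  rw [show 2 * 2 - 1 = 3 from rfl, h8]
  have h5 : (2 : ℝ) ^ (5 * J) ≠ 0 := pow_ne_zero _ two_ne_zero
  field_simp

omit [NeZero L] in
/-- **A prescription of level `≥ 3` plus the pin fixes at least three legs**: the tuples of `prescribedTuples A Ωe` with `Ω p = s` lie among the tuples of `A`
agreeing with `τ′ := (p ↦ s, i ↦ Ωe i)` on `E′ := insert p (support Ωe)`, `|E′| ≥ 3`; hence their number is at most any three-anchor count `N₃` of `A`. -/
theorem card_filter_prescribedTuples_le_of_threeCount {m N : ℕ} (A : Finset (Fin m → SectorLeg N)) {N₃ : ℝ}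
    (hN3 : ∀ (E : Finset (Fin m)), 3 ≤ E.card → ∀ τ : Fin m → SectorLeg N,
      (((A.filter (fun Ω : Fin m → SectorLeg N => ∀ e ∈ E, Ω e = τ e)).card : ℕ) : ℝ) ≤ N₃)
    (Ωe : Fin m → Option (SectorLeg N)) (hΩe : 3 ≤ levelCount Ωe) (p : Fin m) (s : SectorLeg N) :
    ((((prescribedTuples A Ωe).filter (fun Ω : Fin m → SectorLeg N => Ω p = s)).card : ℕ) : ℝ) ≤ N₃ := by
  set E' : Finset (Fin m) := insert p (univ.filter fun i => (Ωe i).isSome) with hE'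
  set τ' : Fin m → SectorLeg N := fun i => if i = p then s else (Ωe i).getD s with hτ'
  have hcard : 3 ≤ E'.card := le_trans (by rw [← levelCount]; exact hΩe) (card_le_card (subset_insert _ _))
  refine le_trans ?_ (hN3 E' hcard τ')
  exact_mod_cast card_le_card fun Ω hΩ => by
    simp only [mem_filter, prescribedTuples] at hΩ
    obtain ⟨⟨hA, hpres⟩, hp⟩ := hΩ
    refine mem_filter.2 ⟨hA, fun e he => ?_⟩
    rw [hE', mem_insert, mem_filter] at he
    rcases he with rfl | ⟨-, hsome⟩
    · simp [hτ', hp]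
    · by_cases hep : e = p
      · subst hep; simp [hτ', hp]
      · obtain ⟨s', hs'⟩ := Option.isSome_iff_exists.1 hsome
        have h1 : Ω e = s' := hpres e s' (Option.mem_def.2 hs')
        simp [hτ', hep, hs', h1]

/-- **THE LEVELLED FOUR-LEG NORM AT LEVELS `≥ 3` FROM A THREE-ANCHOR COUNT**: for every prescription `Ωe` with `levelCount Ωe ≥ 3`, a three-anchor count `N₃` of
`bgmSectorSet (F_J) 4` and an all-fixed anisotropic pinned line `Bₐ` (every compatible tuple, any leg pinned anywhere) give `klLevNormOf … J 4 T Ωe ≤ N₃·Bₐ`.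
[cite: BenfattoGiulianiMastropietro2006, §2.8 (2.76)-(2.77), (2.96)-(2.98)] -/
theorem klLevNormOf_four_le_threeCount_mul (β μ : ℝ) (K : TrigPolyC4v) (J : ℕ) (T : HubbardGrassmann L M)
    (Ωe : Fin 4 → Option (SectorLeg (sectorCount J))) (hΩe : 3 ≤ levelCount Ωe) {N₃ Bₐ : ℝ} (hN0 : 0 ≤ N₃) (hB : 0 ≤ Bₐ)
    (hN3 : ∀ (E : Finset (Fin 4)), 3 ≤ E.card → ∀ τ : Fin 4 → SectorLeg (sectorCount J),
      ((((bgmSectorSet L M (klAnisoFamily L M β μ K klE0 J) 4).filter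
        (fun Ω : Fin 4 → SectorLeg (sectorCount J) => ∀ e ∈ E, Ω e = τ e)).card : ℕ) : ℝ) ≤ N₃)
    (hline : ∀ Ω ∈ bgmSectorSet L M (klAnisoFamily L M β μ K klE0 J) 4, ∀ (p : Fin 4) (x : SpaceTimeIdx L M),
      imagTimeWeight β M ^ 3 * ∑ X ∈ univ.filter (fun X : Fin 4 → SpaceTimeIdx L M => X p = x),
        ‖sectorisedKernel L M β (klAnisoFamily L M β μ K klE0 J) T 4 Ω X‖ ≤ Bₐ) :
    klLevNormOf L M β μ K J 4 T Ωe ≤ N₃ * Bₐ := by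
  unfold klLevNormOf
  rw [hubbardSectorKernelNorm_def]
  refine sectorisedKernelNorm_le_card_mul (imagTimeWeight β M) (m := 3) _ _ hN0 hB
    (fun p s => card_filter_prescribedTuples_le_of_threeCount _ hN3 Ωe hΩe p s)
    (fun Ω hΩ p x => hline Ω (prescribedTuples_subset _ _ hΩ) p x)

/-! ## §2 The tower instance at levels `≥ 3` -/

/-- **THE MEASURED LEVELLED QUARTIC SIZE OF BLOCK `k` AT LEVELS `F ≥ 3` FROM A THREE-ANCHOR COUNT** (input `𝒱_{dk}` at `F_{dk−1}`):
`klTowerMeasLev … d k 4 F ≤ N₃·Bₐ` — no `sectorCount` factor. [cite: BenfattoGiulianiMastropietro2006, §2.8 (2.96)-(2.98), Lemma 2.5] -/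
theorem klTowerMeasLev_four_le_threeCount_mul [NeZero M] (β U μ : ℝ) (K : TrigPolyC4v) (d k : ℕ) {F : ℕ} (hF : 3 ≤ F)
    {N₃ Bₐ : ℝ} (hN0 : 0 ≤ N₃) (hB : 0 ≤ Bₐ)
    (hN3 : ∀ (E : Finset (Fin 4)), 3 ≤ E.card → ∀ τ : Fin 4 → SectorLeg (sectorCount (d * k - 1)),
      ((((bgmSectorSet L M (klAnisoFamily L M β μ K klE0 (d * k - 1)) 4).filter
        (fun Ω : Fin 4 → SectorLeg (sectorCount (d * k - 1)) => ∀ e ∈ E, Ω e = τ e)).card : ℕ) : ℝ) ≤ N₃)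
    (hline : ∀ Ω ∈ bgmSectorSet L M (klAnisoFamily L M β μ K klE0 (d * k - 1)) 4, ∀ (p : Fin 4) (x : SpaceTimeIdx L M),
      imagTimeWeight β M ^ 3 * ∑ X ∈ univ.filter (fun X : Fin 4 → SpaceTimeIdx L M => X p = x),
        ‖sectorisedKernel L M β (klAnisoFamily L M β μ K klE0 (d * k - 1)) (klTowerInput L M β U μ K d k) 4 Ω X‖ ≤ Bₐ) :
    klTowerMeasLev L M β U μ K d k 4 F ≤ N₃ * Bₐ := by
  unfold klTowerMeasLev
  refine Real.iSup_le (fun Ωe => ?_) (mul_nonneg hN0 hB)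
  exact klLevNormOf_four_le_threeCount_mul β μ K (d * k - 1) _ Ωe.1 (by rw [Ωe.2]; exact hF) hN0 hB hN3 hline

/-! ## §3 The floor array of degree `4`, all tracks -/

/-- **THE FLOOR IMPORT AT FOUR LEGS** («(ℓ)-IMPORT-ι₂-FLOOR» cured modulo the three-anchor count): under the doors of the one-anchor count
(`card_bgmSectorSet_klAniso_anchored_le_doors`: `R` with `0 ≤ R.Gfr j`, `0 < c ≤ klThinCountC₃ R`, `0 < U ≤ klThinCountU₀ R`, `klBetaMin ≤ β ≤ e^{c/U²}`,
`μ ∈ klWindowC`, a frame with `FrameOK R U (nScales β) ν K`), a three-anchor count `N₃` of the input family `F_{dk−1}` and an all-fixed anisotropic pinned line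
`Bₐ` of the quartic kernel of `𝒱_{dk}`: **`klTowerMuLevF … d k 2 ≤ (1458·klThinCountC + 531441·N₃)·Bₐ/ε³`** — tracks `0, 1` by the one-anchor count
(`sectorCount J = 2·2^J` against the unit `ε³·2^J`), tracks `2, 3` by the three-anchor count (unit `ε³`), track `4` empty.
[cite: BenfattoGiulianiMastropietro2006, §2.7 (2.71a), §2.8 (2.96)-(2.98), Lemma 2.5] -/
theorem klTowerMuLevF_two_le_floor_import [NeZero M] {R : RenConsts} (hR : ∀ j, 0 ≤ R.Gfr j) {c : ℝ} (hc : 0 < c) (hc₃ : c ≤ klThinCountC₃ R)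
    {U : ℝ} (hU : 0 < U) (hU₀ : U ≤ klThinCountU₀ R) {β : ℝ} (hβ : klBetaMin ≤ β) (hβc : β ≤ Real.exp (c / U ^ 2)) {μ : ℝ} (hμ : μ ∈ klWindowC)
    (ν : ℝ) {K : TrigPolyC4v} (hK : FrameOK R U (nScales β) ν K) (d k : ℕ) {N₃ Bₐ : ℝ} (hN0 : 0 ≤ N₃) (hB : 0 ≤ Bₐ)
    (hN3 : ∀ (E : Finset (Fin 4)), 3 ≤ E.card → ∀ τ : Fin 4 → SectorLeg (sectorCount (d * k - 1)),
      ((((bgmSectorSet L M (klAnisoFamily L M β μ K klE0 (d * k - 1)) 4).filter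
        (fun Ω : Fin 4 → SectorLeg (sectorCount (d * k - 1)) => ∀ e ∈ E, Ω e = τ e)).card : ℕ) : ℝ) ≤ N₃)
    (hline : ∀ Ω ∈ bgmSectorSet L M (klAnisoFamily L M β μ K klE0 (d * k - 1)) 4, ∀ (p : Fin 4) (x : SpaceTimeIdx L M),
      imagTimeWeight β M ^ 3 * ∑ X ∈ univ.filter (fun X : Fin 4 → SpaceTimeIdx L M => X p = x),
        ‖sectorisedKernel L M β (klAnisoFamily L M β μ K klE0 (d * k - 1)) (klTowerInput L M β U μ K d k) 4 Ω X‖ ≤ Bₐ) :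
    klTowerMuLevF L M β U μ K d k 2 ≤ (1458 * klThinCountC + 531441 * N₃) * Bₐ / imagTimeWeight β M ^ 3 := by
  have hβ0 : 0 < β := KLRegimeSplit.pos_of_klBetaMin_le hβ
  have hε : 0 < imagTimeWeight β M := imagTimeWeight_pos_of_pos (M := M) hβ0
  have hC : 0 ≤ klThinCountC := klThinCountC_pos.le
  set J := d * k - 1 with hJ
  -- the two level bounds
  have h1 : ∀ F, klTowerMeasLev L M β U μ K d k 4 F ≤ klThinCountC * sectorCount J * Bₐ := fun F =>
    klTowerMeasLev_four_le_thinCount_mul hR hc hc₃ hU hU₀ hβ hβc hμ ν hK d k F hB hline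
  have h3 : ∀ F, 3 ≤ F → klTowerMeasLev L M β U μ K d k 4 F ≤ N₃ * Bₐ := fun F hF =>
    klTowerMeasLev_four_le_threeCount_mul β U μ K d k hF hN0 hB hN3 hline
  have hsc : (sectorCount J : ℝ) = 2 * (2 : ℝ) ^ J := by simp [sectorCount, pow_succ, mul_comm]
  -- the bound per track
  have htrack : ∀ t : Fin 5, klTowerMuLevAtF L M β U μ K d t k 2 ≤ (1458 * klThinCountC + 531441 * N₃) * Bₐ / imagTimeWeight β M ^ 3 := by
    intro t
    have hU0 : 0 < klLevUnitF β M t 2 J := klLevUnitF_pos hβ0 t 2 J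
    unfold klTowerMuLevAtF
    rw [show 2 * 2 = 4 from rfl, ← hJ, div_le_iff₀ hU0, klLevUnitF_two_eq]
    have hM0 : 0 ≤ klTowerMeasLev L M β U μ K d k 4 ((t : ℕ) + 1) := klTowerMeasLev_nonneg hβ0.le U μ K d k _ _
    fin_cases t
    · -- track 0: one anchor, unit `ε³·2^J`
      have hg : klLevGain (0 : Fin 5) * J = 0 := by rw [show klLevGain (0 : Fin 5) = 0 from rfl, zero_mul]
      simp only [Fin.zero_eta, zero_add, pow_one, hg, pow_zero, div_one]
      have := h1 1
      rw [hsc] at this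
      calc (27 : ℝ) * klTowerMeasLev L M β U μ K d k 4 1 ≤ 27 * (klThinCountC * (2 * (2 : ℝ) ^ J) * Bₐ) := by gcongr
        _ = (54 * klThinCountC) * Bₐ / imagTimeWeight β M ^ 3 * (imagTimeWeight β M ^ 3 * (2 : ℝ) ^ J) := by field_simp; ring
        _ ≤ (1458 * klThinCountC + 531441 * N₃) * Bₐ / imagTimeWeight β M ^ 3 * (imagTimeWeight β M ^ 3 * (2 : ℝ) ^ J) := by
            gcongr; nlinarith
    · -- track 1: one anchor, unit `ε³·2^J`
      have hg : klLevGain (1 : Fin 5) * J = 0 := by rw [show klLevGain (1 : Fin 5) = 0 from rfl, zero_mul]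
      simp only [Fin.mk_one, hg, pow_zero, div_one]
      have := h1 2
      rw [hsc] at this
      calc (27 : ℝ) ^ (1 + 1) * klTowerMeasLev L M β U μ K d k 4 (1 + 1) ≤ 27 ^ (1 + 1) * (klThinCountC * (2 * (2 : ℝ) ^ J) * Bₐ) := by gcongr
        _ = (1458 * klThinCountC) * Bₐ / imagTimeWeight β M ^ 3 * (imagTimeWeight β M ^ 3 * (2 : ℝ) ^ J) := by field_simp; ring
        _ ≤ (1458 * klThinCountC + 531441 * N₃) * Bₐ / imagTimeWeight β M ^ 3 * (imagTimeWeight β M ^ 3 * (2 : ℝ) ^ J) := by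
            gcongr; nlinarith
    · -- track 2: three anchors, unit `ε³`
      have hg : klLevGain (2 : Fin 5) * J = J := by rw [show klLevGain (2 : Fin 5) = 1 from rfl, one_mul]
      simp only [Fin.reduceFinMk, hg]
      have h2J : (0 : ℝ) < (2 : ℝ) ^ J := by positivity
      rw [show imagTimeWeight β M ^ 3 * (2 : ℝ) ^ J / (2 : ℝ) ^ J = imagTimeWeight β M ^ 3 from mul_div_cancel_right₀ _ h2J.ne']
      have := h3 3 le_rfl
      calc (27 : ℝ) ^ (2 + 1) * klTowerMeasLev L M β U μ K d k 4 (2 + 1) ≤ 27 ^ (2 + 1) * (N₃ * Bₐ) := by gcongr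
        _ = (19683 * N₃) * Bₐ / imagTimeWeight β M ^ 3 * imagTimeWeight β M ^ 3 := by field_simp; ring
        _ ≤ (1458 * klThinCountC + 531441 * N₃) * Bₐ / imagTimeWeight β M ^ 3 * imagTimeWeight β M ^ 3 := by
            gcongr; nlinarith
    · -- track 3: three anchors, unit `ε³`
      have hg : klLevGain (3 : Fin 5) * J = J := by rw [show klLevGain (3 : Fin 5) = 1 from rfl, one_mul]
      simp only [Fin.reduceFinMk, hg]
      have h2J : (0 : ℝ) < (2 : ℝ) ^ J := by positivity
      rw [show imagTimeWeight β M ^ 3 * (2 : ℝ) ^ J / (2 : ℝ) ^ J = imagTimeWeight β M ^ 3 from mul_div_cancel_right₀ _ h2J.ne']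
      have := h3 4 (by norm_num)
      calc (27 : ℝ) ^ (3 + 1) * klTowerMeasLev L M β U μ K d k 4 (3 + 1) ≤ 27 ^ (3 + 1) * (N₃ * Bₐ) := by gcongr
        _ = (531441 * N₃) * Bₐ / imagTimeWeight β M ^ 3 * imagTimeWeight β M ^ 3 := by field_simp; ring
        _ ≤ (1458 * klThinCountC + 531441 * N₃) * Bₐ / imagTimeWeight β M ^ 3 * imagTimeWeight β M ^ 3 := by
            gcongr; nlinarith
    · -- track 4: level 5 > 4 legs, empty
      simp only [Fin.reduceFinMk]
      rw [klTowerMeasLev_eq_zero_of_lt β U μ K d k (by norm_num : 4 < 4 + 1), mul_zero]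
      positivity
  -- the track-blind array is the maximum over the tracks
  obtain ⟨t, ht⟩ := exists_klTowerMuLevF_eq (L := L) (M := M) β U μ K d k 2
  rw [ht]
  exact htrack t

end Summit.HubbardSuperconductivity.HubbardSuperconductivity.Theorems.EngineV8

end
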